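import Summits.AnomalousDissipation.AnomalousDissipation.Theorems.SolenoidalFractalHomogenisationLagrangianStepSidebandCrushedResponseNu
import HarnessLib

/-!
# K1L_D `stub_D1_V0thg` (stmt-AnomalousDissipation-27980), R3′ lane, R3′-2 engine brick: THE STATIC-LINK AND SOURCE-OFF BOOKKEEPING of the crushed
# periodic response (discharging `hstatic` / `hsrc` of `Sideband.norm_responseExt_le_crushed_nu` from slot-order data)

Helper file of route `SolenoidalFractalHomogenisation` (`--supports stmt-AnomalousDissipation-27980 --as helper`; one-generation hand
`leafhand-ad-solenoidalfractalh-1` g1, road E-c).  For an arbitrary word `W₁`: source slot `j'` (fibres `± m_{j'}`), hopping slot `i ≠ j'`, and the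
SAME-PERIOD / PREVIOUS-PERIOD placement of the source window:
* `linkCoeff_eq_zero_of_static` — a slot `l` with `ê_l·m_{j'} = 0` never links a fibre `± m_{j'}` to a neighbour (`ê_l ⊥ m_l`): its link coefficient vanishes
  at every `z = ± m_{j'} ± m_l`;
* `slotEnvelope_eq_zero_of_lt_of_lt_start`, `slotEnvelope_eq_zero_of_lt_of_end_le` — which slots can be active at a time of `[0, P)`;
* **`hstatic_of_lt`** (`j' < i`, source window at `a = start_{j'}`, `s = startᵢ`) and **`hstatic_of_gt`** (`i < j'`, source window one period earlier,
  `a = start_{j'} − P`, `s = startᵢ`): if every slot `l ≠ j'` cyclically strictly between `j'` and `i` is STATIC for `m_{j'}` (`ê_l·m_{j'} = 0`), then on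
  `[a, s)` no active link joins `{± m_{j'}}` to a retained fibre outside it — the `hstatic` hypothesis of `norm_responseExt_le_of_ladderCrush` /
  `norm_responseExt_le_crushed_nu` (with `p = 0`);
* **`hsrc_of_lt`**, **`hsrc_of_gt`** — the envelope of `j'` vanishes on `[startᵢ, a + P]` in the two placements (the `hsrc` hypothesis);
* `window_of_lt`, `window_of_gt` — `a ≤ s` and `e ≤ a + P` in the two placements.
No definitions, no sorry.  NOT a proof of `stub_D1_V0thg`, of K1L_D or of AD; rung F-D1.A0 infrastructure.
-/

set_option linter.dupNamespace false -- single-conjunct summit: `Summit.AnomalousDissipation.AnomalousDissipation.…` is the mandated namespace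

noncomputable section

namespace Summit.AnomalousDissipation.AnomalousDissipation.Theorems.SolenoidalFractalHomogenisation.LagrangianStep.Sideband

open Set Complex MeasureTheory
open scoped InnerProductSpace
open Literature.Analysis Literature.Analysis.FunctionSpaces Literature.Analysis.FunctionSpaces.Torus
open Literature.Analysis.FluidPDE Literature.Analysis.FluidPDE.Torus Literature.Analysis.FluidPDE.LatticeShear
open Summit.AnomalousDissipation.AnomalousDissipation.Theorems.SolenoidalFractalHomogenisation.LagrangianStep.CellChain (linkCoeff)
open Summit.AnomalousDissipation.AnomalousDissipation.Theorems.SolenoidalFractalHomogenisation.PermissibleCarrier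
  (period_pos start_nonneg start_add_tau_le_period)
open Summit.AnomalousDissipation.AnomalousDissipation.Theorems.SolenoidalFractalHomogenisation.RealisedQuasiStaticCellLaw (start_add_tau_le_start)

variable {k₀ : ℕ}

/-! ## §1 Static slots never link the source fibres -/

/-- **A STATIC slot does not link `± m_{j'}` to its neighbours.**  If `ê_l·m' = 0` then the link coefficient of slot `l` vanishes at every
`z` with `z ∓ m_l ∈ {m', −m'}` (because `ê_l·z = ± ê_l·m' ± ê_l·m_l = 0`). [cite: MeshalkinSinai1961, pp. 1700–1705] -/
theorem linkCoeff_eq_zero_of_static (W₁ : LatticeWord k₀) (l : Fin k₀) {m' : Fin 3 → ℤ}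
    (hstat : ∑ a, ((W₁.phase l).e a : ℂ) * (m' a : ℂ) = 0) (t : ℝ) {z w : Fin 3 → ℤ}
    (hw : w = z - (W₁.phase l).m ∨ w = z + (W₁.phase l).m) (hw' : w = m' ∨ w = -m') : linkCoeff W₁ 1 z l t = 0 := by
  refine linkCoeff_eq_zero_of_sum_eq_zero W₁ t ?_
  have hm := sum_e_mul_m_eq_zero W₁ l
  have hmw : ∑ a, ((W₁.phase l).e a : ℂ) * (w a : ℂ) = 0 := by
    rcases hw' with rfl | rfl
    · exact hstat
    · simp only [Pi.neg_apply, Int.cast_neg, mul_neg, Finset.sum_neg_distrib, hstat, neg_zero]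
  have hz : z = w + (W₁.phase l).m ∨ z = w - (W₁.phase l).m := by
    rcases hw with rfl | rfl
    · exact Or.inl (by rw [sub_add_cancel])
    · exact Or.inr (by rw [add_sub_cancel_right])
  rcases hz with rfl | rfl
  · simp only [Pi.add_apply, Int.cast_add, mul_add, Finset.sum_add_distrib, hmw, hm, add_zero]
  · simp only [Pi.sub_apply, Int.cast_sub, mul_sub, Finset.sum_sub_distrib, hmw, hm, sub_zero]

/-! ## §2 Which slots can be active at a time of `[0, P)` -/

/-- A slot starting later than `t ≥ 0` is off at `t`. [cite: ArmstrongVicol2025, §3 (time cut-offs)] -/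
theorem slotEnvelope_eq_zero_of_lt_start_of_le (W₁ : LatticeWord k₀) {i l : Fin k₀} (hil : i ≤ l) {t : ℝ} (h0 : 0 ≤ t) (ht : t ≤ W₁.start i) :
    slotEnvelope W₁ l t = 0 := by
  rcases eq_or_lt_of_le hil with rfl | hlt
  · exact slotEnvelope_eq_zero_of_le_start W₁ _ h0 ht
  · exact slotEnvelope_eq_zero_of_le_start W₁ l h0
      (ht.trans ((le_add_of_nonneg_right (W₁.phase i).τ_pos.le).trans (start_add_tau_le_start W₁ hlt)))

/-- A slot ending before `t ≤ P` is off at `t`. [cite: ArmstrongVicol2025, §3 (time cut-offs)] -/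
theorem slotEnvelope_eq_zero_of_lt_of_start_le (W₁ : LatticeWord k₀) {l j : Fin k₀} (hlj : l < j) {t : ℝ} (ht : W₁.start j ≤ t) (hP : t ≤ W₁.period) :
    slotEnvelope W₁ l t = 0 :=
  slotEnvelope_eq_zero_of_end_le W₁ l ((start_add_tau_le_start W₁ hlj).trans ht) hP

/-! ## §3 The `hstatic` hypothesis from static intermediate slots -/

/-- **`hstatic`, SAME-PERIOD PLACEMENT** (`j' < i`): if every slot `l` with `j' < l < i` is static for `m_{j'}`, then on `[start_{j'}, startᵢ)` no active link
joins `{± m_{j'}}` to a retained fibre outside it. [cite: MeshalkinSinai1961, pp. 1700–1705] [cite: ArmstrongVicol2025, §3] -/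
theorem hstatic_of_lt (W₁ : LatticeWord k₀) {j' i : Fin k₀}
    (hstat : ∀ l : Fin k₀, j' < l → l < i → ∑ a, ((W₁.phase l).e a : ℂ) * ((W₁.phase j').m a : ℂ) = 0) (R : ℕ) :
    ∀ t ∈ Ico (W₁.start j') (W₁.start i), ∀ (l : Fin k₀) (z : box R), (z : Fin 3 → ℤ) ≠ (W₁.phase j').m → (z : Fin 3 → ℤ) ≠ -(W₁.phase j').m →
      ∀ w : Fin 3 → ℤ, (w = z.1 - (W₁.phase l).m ∨ w = z.1 + (W₁.phase l).m) → w ∈ box R →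
      (w = (W₁.phase j').m ∨ w = -(W₁.phase j').m) → linkCoeff W₁ 1 z.1 l t = 0 := by
  intro t ht l z _ _ w hw _ hw'
  have h0 : 0 ≤ t := (start_nonneg W₁ j').trans ht.1
  have hP : t ≤ W₁.period := ht.2.le.trans ((le_add_of_nonneg_right (W₁.phase i).τ_pos.le).trans (start_add_tau_le_period W₁ i))
  by_cases hl₁ : l < j'
  · exact linkCoeff_eq_zero_of_slotEnvelope W₁ _ (slotEnvelope_eq_zero_of_lt_of_start_le W₁ hl₁ ht.1 hP)
  by_cases hl₂ : i ≤ l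
  · exact linkCoeff_eq_zero_of_slotEnvelope W₁ _ (slotEnvelope_eq_zero_of_lt_start_of_le W₁ hl₂ h0 ht.2.le)
  rcases eq_or_lt_of_le (not_lt.1 hl₁) with hl | hl
  · subst hl
    exact linkCoeff_eq_zero_of_static W₁ j' (sum_e_mul_m_eq_zero W₁ j') t hw hw'
  · exact linkCoeff_eq_zero_of_static W₁ l (hstat l hl (not_le.1 hl₂)) t hw hw'

/-- **`hstatic`, PREVIOUS-PERIOD PLACEMENT** (`i < j'`, the source window one period earlier: `a = start_{j'} − P`): if every slot `l` with `j' < l` or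
`l < i` is static for `m_{j'}`, then on `[start_{j'} − P, startᵢ)` no active link joins `{± m_{j'}}` to a retained fibre outside it.
[cite: MeshalkinSinai1961, pp. 1700–1705] [cite: ArmstrongVicol2025, §3] -/
theorem hstatic_of_gt (W₁ : LatticeWord k₀) {j' i : Fin k₀} (hij : i < j')
    (hstat : ∀ l : Fin k₀, j' < l ∨ l < i → ∑ a, ((W₁.phase l).e a : ℂ) * ((W₁.phase j').m a : ℂ) = 0) (R : ℕ) :
    ∀ t ∈ Ico (W₁.start j' - W₁.period) (W₁.start i), ∀ (l : Fin k₀) (z : box R), (z : Fin 3 → ℤ) ≠ (W₁.phase j').m →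
      (z : Fin 3 → ℤ) ≠ -(W₁.phase j').m →
      ∀ w : Fin 3 → ℤ, (w = z.1 - (W₁.phase l).m ∨ w = z.1 + (W₁.phase l).m) → w ∈ box R →
      (w = (W₁.phase j').m ∨ w = -(W₁.phase j').m) → linkCoeff W₁ 1 z.1 l t = 0 := by
  intro t ht l z _ _ w hw _ hw'
  by_cases hlj : l = j'
  · subst hlj
    exact linkCoeff_eq_zero_of_static W₁ l (sum_e_mul_m_eq_zero W₁ l) t hw hw'
  by_cases hst : j' < l ∨ l < i
  · exact linkCoeff_eq_zero_of_static W₁ l (hstat l hst) t hw hw'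
  -- the remaining slots `i ≤ l < j'` are off on the whole window
  have hl₁ : l < j' := lt_of_le_of_ne (not_lt.1 (not_or.1 hst).1) hlj
  have hl₂ : i ≤ l := not_lt.1 (not_or.1 hst).2
  refine linkCoeff_eq_zero_of_slotEnvelope W₁ _ ?_
  rcases lt_or_ge t 0 with h0 | h0
  · -- `t + P ∈ [start_{j'}, P)`: slot `l < j'` has ended
    have h := slotEnvelope_add_int_mul_period W₁ l (t + W₁.period) (-1)
    rw [show t + W₁.period + ((-1 : ℤ) : ℝ) * W₁.period = t by push_cast; ring] at h
    rw [h]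
    exact slotEnvelope_eq_zero_of_lt_of_start_le W₁ hl₁ (by linarith [ht.1]) (by linarith)
  · exact slotEnvelope_eq_zero_of_lt_start_of_le W₁ hl₂ h0 ht.2.le

/-! ## §4 The `hsrc` hypothesis: the source is off from the hopping slot to its next occurrence -/

/-- **`hsrc`, SAME-PERIOD PLACEMENT** (`j' < i`): the envelope of `j'` vanishes on `[startᵢ, start_{j'} + P]`. [cite: ArmstrongVicol2025, §3 (time cut-offs)] -/
theorem hsrc_of_lt (W₁ : LatticeWord k₀) {j' i : Fin k₀} (hji : j' < i) :
    ∀ t ∈ Icc (W₁.start i) (W₁.start j' + W₁.period), slotEnvelope W₁ j' t = 0 := by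
  intro t ht
  rcases le_or_gt t W₁.period with hP | hP
  · exact slotEnvelope_eq_zero_of_lt_of_start_le W₁ hji ht.1 hP
  · have h := slotEnvelope_add_int_mul_period W₁ j' (t - W₁.period) 1
    rw [show t - W₁.period + ((1 : ℤ) : ℝ) * W₁.period = t by push_cast; ring] at h
    rw [h]
    exact slotEnvelope_eq_zero_of_le_start W₁ j' (by linarith) (by linarith [ht.2])

/-- **`hsrc`, PREVIOUS-PERIOD PLACEMENT** (`i < j'`): the envelope of `j'` vanishes on `[startᵢ, (start_{j'} − P) + P]`. [cite: ArmstrongVicol2025, §3 (time cut-offs)] -/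
theorem hsrc_of_gt (W₁ : LatticeWord k₀) (j' i : Fin k₀) :
    ∀ t ∈ Icc (W₁.start i) (W₁.start j' - W₁.period + W₁.period), slotEnvelope W₁ j' t = 0 := by
  intro t ht
  rw [sub_add_cancel] at ht
  exact slotEnvelope_eq_zero_of_le_start W₁ j' ((start_nonneg W₁ i).trans ht.1) ht.2

/-! ## §5 The window constraints of the two placements -/

/-- Same-period placement: `start_{j'} ≤ startᵢ` and `startᵢ + τᵢ ≤ start_{j'} + P`. [cite: ArmstrongVicol2025, §3] -/
theorem window_of_lt (W₁ : LatticeWord k₀) {j' i : Fin k₀} (hji : j' < i) :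
    W₁.start j' ≤ W₁.start i ∧ W₁.start i + (W₁.phase i).τ ≤ W₁.start j' + W₁.period :=
  ⟨(le_add_of_nonneg_right (W₁.phase j').τ_pos.le).trans (start_add_tau_le_start W₁ hji),
    (start_add_tau_le_period W₁ i).trans (le_add_of_nonneg_left (start_nonneg W₁ j'))⟩

/-- Previous-period placement: `start_{j'} − P ≤ startᵢ` and `startᵢ + τᵢ ≤ (start_{j'} − P) + P`. [cite: ArmstrongVicol2025, §3] -/
theorem window_of_gt (W₁ : LatticeWord k₀) {j' i : Fin k₀} (hij : i < j') :
    W₁.start j' - W₁.period ≤ W₁.start i ∧ W₁.start i + (W₁.phase i).τ ≤ W₁.start j' - W₁.period + W₁.period := by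
  refine ⟨?_, by rw [sub_add_cancel]; exact start_add_tau_le_start W₁ hij⟩
  have h1 : W₁.start j' ≤ W₁.period := (le_add_of_nonneg_right (W₁.phase j').τ_pos.le).trans (start_add_tau_le_period W₁ j')
  linarith [start_nonneg W₁ i]

end Summit.AnomalousDissipation.AnomalousDissipation.Theorems.SolenoidalFractalHomogenisation.LagrangianStep.Sideband

end
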